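import Summits.NavierStokesRegularity.FluidComputer.SummedOccupationBridge
import Summits.NavierStokesRegularity.FluidComputer.BlockEnergyTransport
import Literature.Analysis.FluidPDE.NSLerayBlowupRateTopHolds
import Literature.Analysis.FluidPDE.NSLerayBlowupRateHolds
import Literature.Analysis.FluidPDE.MollifiedSliceTools
import HarnessLib

/-!
# Fluid computer — the TIME FACE of the level dictionary, III: LERAY'S AMPLITUDE CLOCK (L21, L22)

HONEST FRAMING (cell `pub-fluidc`, verbatim): *low prior, high value-of-information experiment on Tao's
machine paradigm; NOT a claim that NS blows up.* Theorem side of the cell; nothing here is evidence of blow-up.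
Companion of `LerayClock` (L19, the enstrophy clock) and `LerayFrontClock` (L20, its level form): the countdown
in the AMPLITUDE currency of the dictionary — the sup norm `‖u(t)‖_∞` and the block sups
`s_j(t) = ‖Δ̇_j u(t)‖_∞` in which Cheskidov–Shvydkoy saturation (`s_j ≥ b ν 2^j`, L1–L11) is written. For every
maximal smooth solution `(u, p)` of the unforced Navier–Stokes system on `ℝ³ × [0, T)` (`ν > 0`) which is
Leray–Hopf from `u 0`:

* `supNorm_clock` (**L21, LERAY'S `L^∞` CLOCK WITHOUT A BOUNDEDNESS HYPOTHESIS**) — an absolute `c > 0` with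
  `c √ν / √(T − t) ≤ ‖u(t)‖_∞` for EVERY `t ∈ (0, T)` (Leray 1934, §19, (3.9)). The tree's ns.S28
  `leray_blowup_rate_top_holds` asks essential boundedness on every closed sub-strip `[0, T'] × ℝ³`; for the
  dictionary's class this is DISCHARGED here: restart at an a.e.-good time `s < t`
  (`IsLerayHopfOn.exists_isLerayHopfOn_restart_Ioo`, maximality of the translate
  `IsMaximalSmoothSolution.translate_zero`), the translate being bounded on closed sub-strips by far-field
  ε-regularity (`SereginSverak2002.farField_bound`) plus compact continuity (`exists_bound_window`).
  `Lr_clock` (**L21′**): the same for Leray's `L^r` rates, `3 < r < ∞`: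
  `c_r ν^{(r+3)/(2r)} (T − t)^{−(r−3)/(2r)} ≤ ‖u(t)‖_r` (`leray_blowup_rate_holds`).
* `eLpNorm_top_le_tsum_blockSup` — the Littlewood–Paley bridge `‖v‖_∞ ≤ ∑_{j∈ℤ} ‖Δ̇_j v‖_∞` for smooth `L²`
  fields (reconstruction in `L^∞` of a field whose low-frequency cut-offs vanish, BCD Prop. 2.12).
* `blockSup_sum_clock` (**L22, THE CLOCK IN BLOCK-SUP CURRENCY**) — `c √ν/√(T − t) ≤ ∑_{j∈ℤ} s_j(t)` at every
  `t ∈ (0, T)`: the summed block sups diverge at Leray's rate.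
* `tsum_blockSup_eq_low_add_tail`, `supFront_clock` (**L22′, THE AMPLITUDE-FRONT CLOCK**) — splitting at a
  level `J`, the low part is at most `C_∞ G ‖u(0)‖₂ 2^{3(J−1)/2}` (low-frequency Bernstein
  `LPBounds.tsum_blockSup_low_le`, `G = ∑_n 2^{−3n/2}`, and Leray's energy inequality), so
  `c √ν/√(T − t) ≤ C_∞ G ‖u(0)‖₂ 2^{3(J−1)/2} + ∑_{n≥0} s_{J+n}(t)` for every `J` at every instant;
  `supCountdown` (**L22″**, real numbers): if the block sups at and above `J` sum to no more than the energy class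
  allows below `J`, then `c² ν ≤ 4 (C_∞ G)² ‖u(0)‖₂² 2^{3(J−1)} (T − t)` — EACH LEVEL THE AMPLITUDE FRONT HAS NOT
  PASSED CERTIFIES TIME `∝ 8^{−J}`, and the front must climb at least like
  `2^{J(t)} ≳ (ν/(T − t))^{1/3} ‖u(0)‖₂^{−2/3}` — in the amplitude currency the countdown carries `ν`, not `ν³`.

HONEST SIZE NOTE: `c`, `C_∞` inexplicit; `ν ≈ 3.3·10⁻³` at the cell's `ρ = 3`; the exponent `1/3` is the
energy-class exponent, not the self-similar `1/2`. Read against WORDS ('the hand-off clock must accelerate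
geometrically; time-to-blow-up is paid for level by level'), never against a certified atlas number. Necessity
only. 0 sorry; no new definitions, no named facts.

## References

* J. Leray, Acta Math. 63 (1934) 193–248, §19 (3.8)–(3.9), §22. [Leray1934]
* W. S. Ożański, B. C. Pooley, in: *PDEs in Fluid Mechanics*, LMS Lect. Note Ser. 452 (2018), Cor. 6.25 with
  Thm. 6.22. [OzanskiPooley2018]
* H. Bahouri, J.-Y. Chemin, R. Danchin, *Fourier Analysis and Nonlinear PDE*, Springer 2011, Lemma 2.1,
  Prop. 2.12. [BahouriCheminDanchin2011]
-/

noncomputable section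

open MeasureTheory Set Function Filter Topology Metric
open scoped ENNReal NNReal RealInnerProductSpace SchwartzMap
open Literature.Analysis.FluidPDE Literature.Analysis.FunctionSpaces
open Summit.NavierStokesRegularity.FluidComputer.BlockEnergyTransport

namespace Summit.NavierStokesRegularity.FluidComputer.LeraySupClock

/-! ## Interior boundedness and the restart package -/

/-- **Interior boundedness of a classical Leray–Hopf solution**: a classical solution of the unforced system on
`ℝ³ × [0, T)` (`ν > 0`), Leray–Hopf from `u 0`, is BOUNDED on every window `[s, T'] × ℝ³` with
`0 < s`, `T' < T` — in the far field `|x| > R` by ε-regularity (`SereginSverak2002.farField_bound`), on the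
compact `[s, T'] × B̄(0, R)` by continuity. No decay of the datum is needed.
[cite: LemarieRieusset2016, proof of Thm. 14.5 (p. 512) with Thm. 14.4 (p. 505)] -/
theorem exists_bound_window {ν T : ℝ} (hν : 0 < ν) (hT : 0 < T)
    {u : ℝ → EuclideanSpace ℝ (Fin 3) → EuclideanSpace ℝ (Fin 3)} {p : ℝ → EuclideanSpace ℝ (Fin 3) → ℝ}
    (hcl : IsClassicalNSSolutionOn (Ico 0 T) ν 0 u p) (hLH : IsLerayHopfOn T ν 0 (u 0) u)
    {s : ℝ} (hs : 0 < s) {T' : ℝ} (hT' : T' < T) :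
    ∃ M : ℝ, ∀ t ∈ Icc s T', ∀ x, ‖u t x‖ ≤ M := by
  obtain ⟨R, M₁, hfar⟩ := SereginSverak2002.farField_bound hν hT hcl hLH (δ := s / 2) (by linarith)
  set K : Set (ℝ × EuclideanSpace ℝ (Fin 3)) := Icc s T' ×ˢ closedBall (0 : EuclideanSpace ℝ (Fin 3)) R with hK
  have hKc : IsCompact K := isCompact_Icc.prod (isCompact_closedBall _ _)
  have hKsub : K ⊆ Ico 0 T ×ˢ (univ : Set (EuclideanSpace ℝ (Fin 3))) := by
    rintro ⟨t, x⟩ ⟨⟨ht1, ht2⟩, -⟩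
    exact ⟨⟨hs.le.trans ht1, ht2.trans_lt hT'⟩, mem_univ _⟩
  obtain ⟨M₂, hM₂⟩ := hKc.exists_bound_of_continuousOn ((SereginSverak2002.continuousOn_uncurry hcl).mono hKsub)
  refine ⟨max M₁ M₂, fun t ht x => ?_⟩
  rcases lt_or_ge R ‖x‖ with hx | hx
  · exact (hfar t ⟨by linarith [ht.1], ht.2.trans_lt hT'⟩ x hx).trans (le_max_left _ _)
  · exact (hM₂ (t, x) ⟨ht, mem_closedBall_zero_iff.2 hx⟩).trans (le_max_right _ _)

/-- **The translate from an interior time is essentially bounded on every closed sub-strip**: for `0 < s < T` and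
`0 < T' < T − s`, `u(· + s)` is essentially bounded on `[0, T'] × ℝ³` (`exists_bound_window` on `[s, s + T']`) —
the hypothesis of ns.S28 (`leray_blowup_rate_top`, `leray_blowup_rate`), discharged for the translates.
[cite: LemarieRieusset2016, proof of Thm. 14.5 (p. 512) with Thm. 14.4 (p. 505)] -/
theorem eLpNorm_uncurry_translate_lt_top {ν T : ℝ} (hν : 0 < ν) (hT : 0 < T)
    {u : ℝ → EuclideanSpace ℝ (Fin 3) → EuclideanSpace ℝ (Fin 3)} {p : ℝ → EuclideanSpace ℝ (Fin 3) → ℝ}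
    (hcl : IsClassicalNSSolutionOn (Ico 0 T) ν 0 u p) (hLH : IsLerayHopfOn T ν 0 (u 0) u)
    {s : ℝ} (hs : s ∈ Ioo 0 T) {T' : ℝ} (hT' : T' ∈ Ioo 0 (T - s)) :
    eLpNorm (uncurry fun t => u (t + s)) ∞ (volume.restrict (Icc 0 T' ×ˢ univ)) < ∞ := by
  obtain ⟨M, hM⟩ := exists_bound_window hν hT hcl hLH hs.1 (T' := s + T') (by linarith [hT'.2])
  rw [eLpNorm_exponent_top]
  refine eLpNormEssSup_lt_top_of_ae_bound (C := M) ?_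
  rw [ae_restrict_iff' (measurableSet_Icc.prod MeasurableSet.univ)]
  refine ae_of_all _ ?_
  rintro ⟨t, x⟩ ⟨ht, -⟩
  exact hM (t + s) ⟨by linarith [ht.1], by linarith [ht.2]⟩ x

/-! ## L21: Leray's sup-norm and `L^r` clocks, without a boundedness hypothesis -/

/-- **L21 — LERAY'S `L^∞` CLOCK, NO BOUNDEDNESS HYPOTHESIS.** There is an absolute `c > 0` such that for every
`ν > 0`, `T > 0` and every maximal smooth solution `(u, p)` of the unforced Navier–Stokes system on `ℝ³ × [0, T)`
which is Leray–Hopf from `u 0`: `c √ν / √(T − t) ≤ ‖u(t)‖_{L^∞}` for EVERY `t ∈ (0, T)` (in `ℝ≥0∞`) — the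
maximum velocity diverges at least at Leray's self-similar rate, and a flow with `‖u(t)‖_∞ = V` is at least
`c² ν / V²` away from blow-up. ns.S28 (`leray_blowup_rate_top_holds`) applied to the restart at an a.e.-good time
`s ∈ (t/2, t)` (a maximal smooth Leray–Hopf solution with lifespan `T − s`, essentially bounded on closed
sub-strips by `eLpNorm_uncurry_translate_lt_top`). [cite: Leray1934, §19 (3.8)–(3.9) p. 224]
[cite: OzanskiPooley2018, Cor. 6.25 with Thm. 6.22] -/
theorem supNorm_clock :
    ∃ c : ℝ, 0 < c ∧ ∀ (ν T : ℝ), 0 < ν → 0 < T →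
      ∀ (u : ℝ → EuclideanSpace ℝ (Fin 3) → EuclideanSpace ℝ (Fin 3)) (p : ℝ → EuclideanSpace ℝ (Fin 3) → ℝ),
      IsMaximalSmoothSolution ν 0 u p T → IsLerayHopfOn T ν 0 (u 0) u →
      ∀ t ∈ Ioo 0 T, ENNReal.ofReal (c * Real.sqrt ν / Real.sqrt (T - t)) ≤ eLpNorm (u t) ∞ volume := by
  obtain ⟨c, hc, H⟩ := leray_blowup_rate_top_holds
  refine ⟨c, hc, fun ν T hν hT u p hmax hLH t ht => ?_⟩
  -- restart at an a.e.-good time `s ∈ (t/2, t)`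
  obtain ⟨s, hs, hLHs⟩ := hLH.exists_isLerayHopfOn_restart_Ioo hν.le (a := t / 2) (b := t)
    (by linarith [ht.1]) (by linarith [ht.1]) ht.2.le
  have hs0 : 0 < s := by linarith [hs.1, ht.1]
  have hsT : s < T := hs.2.trans ht.2
  have hmaxs := hmax.translate_zero hs0 hsT
  have hLHs' : IsLerayHopfOn (T - s) ν 0 ((fun t => u (t + s)) 0) (fun t => u (t + s)) := by
    simpa only [zero_add] using hLHs
  have hbdd : ∀ T' ∈ Ioo 0 (T - s),
      eLpNorm (uncurry fun t => u (t + s)) ∞ (volume.restrict (Icc 0 T' ×ˢ univ)) < ∞ :=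
    fun T' hT' => eLpNorm_uncurry_translate_lt_top hν hT hmax.1 hLH ⟨hs0, hsT⟩ hT'
  have h := H ν (T - s) hν (sub_pos.2 hsT) _ _ hmaxs hLHs' hbdd (t - s) ⟨by linarith [hs.2], by linarith [ht.2]⟩
  have e1 : T - s - (t - s) = T - t := by ring
  have e2 : u (t - s + s) = u t := by rw [sub_add_cancel]
  rw [e1, e2] at h
  exact h

/-- **L21′ — LERAY'S `L^r` CLOCKS (`3 < r < ∞`), NO BOUNDEDNESS HYPOTHESIS.** For every `3 < r < ∞` there is
`c_r > 0` such that along every maximal smooth Leray–Hopf solution of the unforced system (`ν > 0`):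
`c_r ν^{(r+3)/(2r)} (T − t)^{−(r−3)/(2r)} ≤ ‖u(t)‖_{L^r}` for EVERY `t ∈ (0, T)`. ns.S28 (`leray_blowup_rate_holds`)
on the restart at an a.e.-good time, boundedness discharged as in `supNorm_clock`.
[cite: Leray1934, §22 p. 227] [cite: OzanskiPooley2018, Cor. 6.25] -/
theorem Lr_clock (r : ℝ) (hr : 3 < r) :
    ∃ c : ℝ, 0 < c ∧ ∀ (ν T : ℝ), 0 < ν → 0 < T →
      ∀ (u : ℝ → EuclideanSpace ℝ (Fin 3) → EuclideanSpace ℝ (Fin 3)) (p : ℝ → EuclideanSpace ℝ (Fin 3) → ℝ),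
      IsMaximalSmoothSolution ν 0 u p T → IsLerayHopfOn T ν 0 (u 0) u →
      ∀ t ∈ Ioo 0 T,
        ENNReal.ofReal (c * ν ^ ((r + 3) / (2 * r)) * (T - t) ^ (-((r - 3) / (2 * r)))) ≤
          eLpNorm (u t) (ENNReal.ofReal r) volume := by
  obtain ⟨c, hc, H⟩ := leray_blowup_rate_holds r hr
  refine ⟨c, hc, fun ν T hν hT u p hmax hLH t ht => ?_⟩
  obtain ⟨s, hs, hLHs⟩ := hLH.exists_isLerayHopfOn_restart_Ioo hν.le (a := t / 2) (b := t)
    (by linarith [ht.1]) (by linarith [ht.1]) ht.2.le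
  have hs0 : 0 < s := by linarith [hs.1, ht.1]
  have hsT : s < T := hs.2.trans ht.2
  have hmaxs := hmax.translate_zero hs0 hsT
  have hLHs' : IsLerayHopfOn (T - s) ν 0 ((fun t => u (t + s)) 0) (fun t => u (t + s)) := by
    simpa only [zero_add] using hLHs
  have hbdd : ∀ T' ∈ Ioo 0 (T - s),
      eLpNorm (uncurry fun t => u (t + s)) ∞ (volume.restrict (Icc 0 T' ×ˢ univ)) < ∞ :=
    fun T' hT' => eLpNorm_uncurry_translate_lt_top hν hT hmax.1 hLH ⟨hs0, hsT⟩ hT'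
  have h := H ν (T - s) hν (sub_pos.2 hsT) _ _ hmaxs hLHs' hbdd (t - s) ⟨by linarith [hs.2], by linarith [ht.2]⟩
  have e1 : T - s - (t - s) = T - t := by ring
  have e2 : u (t - s + s) = u t := by rw [sub_add_cancel]
  rw [e1, e2] at h
  exact h

/-! ## L22: the clock in block-sup currency -/

/-- **The Littlewood–Paley bridge in `L^∞`**: for a smooth `L²` field `v : ℝ³ → ℝ³`,
`‖v‖_{L^∞} ≤ ∑_{j ∈ ℤ} ‖Δ̇_j v‖_{L^∞}` (in `[0, ∞]`): the distribution of `v ∈ L²` has vanishing low-frequency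
cut-offs (tree `tendsto_lowFreqCutoff_of_memLp_two_holds`), so the Littlewood–Paley series reconstructs it in
`L^∞` (tree `eLpNormDistrib_le_tsum_lpBlock`), and the dictionary turns distributional norms into function norms.
[cite: BahouriCheminDanchin2011, Prop. 2.12] -/
theorem eLpNorm_top_le_tsum_blockSup {v : EuclideanSpace ℝ (Fin 3) → EuclideanSpace ℝ (Fin 3)}
    (hv : IsSmoothL2Field v) :
    eLpNorm v ∞ volume ≤ ∑' j : ℤ, blockSup v j := by
  haveI : Fact (1 ≤ (∞ : ℝ≥0∞)) := ⟨le_top⟩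
  have hv2 : MemLp v 2 volume := hv.memLp_two
  set V : 𝓢'(EuclideanSpace ℝ (Fin 3), EuclideanSpace ℂ (Fin 3)) :=
    Lp.toTemperedDistribution ((memLp_complexify_comp hv2).toLp _) with hVdef
  have hV : IsDistributionOf v V := isDistributionOf_toTemperedDistribution hv2
  have hvtop : MemLp v ∞ volume := memLp_top_of_hasBoundedDerivs hv.toHasBoundedDerivs
  have h1 : eLpNorm v ∞ volume = eLpNormDistrib ∞ V := (hV.eLpNormDistrib_eq hvtop).symm
  have h0 : Tendsto (fun j : ℤ => lowFreqCutoff j V) atBot (𝓝 0) :=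
    tendsto_lowFreqCutoff_of_memLp_two_holds hv2 hV
  have h2 : eLpNormDistrib ∞ V ≤ ∑' j : ℤ, eLpNormDistrib ∞ (lpBlock j V) := eLpNormDistrib_le_tsum_lpBlock _ h0
  rw [h1]
  refine h2.trans_eq (tsum_congr fun j => ?_)
  rw [hV.eLpNormDistrib_top_lpBlock_eq hv2 j]
  rfl

/-- **L22 — LERAY'S CLOCK IN BLOCK-SUP CURRENCY.** With the constant `c` of `supNorm_clock`: along every
maximal smooth Leray–Hopf solution of the unforced system (`ν > 0`), for EVERY `t ∈ (0, T)`: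
`c √ν / √(T − t) ≤ ∑_{j ∈ ℤ} s_j(t)`, `s_j(t) = ‖Δ̇_j u(t)‖_∞` — the summed block sups, the currency of
Cheskidov–Shvydkoy saturation, diverge at least at Leray's rate. (`supNorm_clock` and the bridge
`eLpNorm_top_le_tsum_blockSup`.) [cite: Leray1934, §19 (3.8)–(3.9) p. 224]
[cite: BahouriCheminDanchin2011, Prop. 2.12] -/
theorem blockSup_sum_clock :
    ∃ c : ℝ, 0 < c ∧ ∀ (ν T : ℝ), 0 < ν → 0 < T →
      ∀ (u : ℝ → EuclideanSpace ℝ (Fin 3) → EuclideanSpace ℝ (Fin 3)) (p : ℝ → EuclideanSpace ℝ (Fin 3) → ℝ),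
      IsMaximalSmoothSolution ν 0 u p T → IsLerayHopfOn T ν 0 (u 0) u →
      ∀ t ∈ Ioo 0 T, ENNReal.ofReal (c * Real.sqrt ν / Real.sqrt (T - t)) ≤ ∑' j : ℤ, blockSup (u t) j := by
  obtain ⟨c, hc, H⟩ := supNorm_clock
  refine ⟨c, hc, fun ν T hν hT u p hmax hLH t ht => (H ν T hν hT u p hmax hLH t ht).trans ?_⟩
  exact eLpNorm_top_le_tsum_blockSup (isSmoothL2Field_slice_of_maximal hν hT hmax hLH ht)

/-- **Splitting the summed block sups at a level `J`**: `∑_{j∈ℤ} s_j = ∑_{n≥0} s_{J−1−n} + ∑_{n≥0} s_{J+n}`.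
[folklore] -/
theorem tsum_blockSup_eq_low_add_tail (v : EuclideanSpace ℝ (Fin 3) → EuclideanSpace ℝ (Fin 3)) (J : ℤ) :
    ∑' j : ℤ, blockSup v j = (∑' n : ℕ, blockSup v (J - 1 - n)) + ∑' n : ℕ, blockSup v (J + n) := by
  rw [← (Equiv.addRight J).tsum_eq]
  simp only [Equiv.coe_addRight]
  rw [tsum_of_nat_of_neg_add_one ENNReal.summable ENNReal.summable, add_comm]
  congr 1
  · refine tsum_congr fun n => ?_
    congr 1
    ring
  · refine tsum_congr fun n => ?_
    rw [add_comm]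

/-- **L22′ — THE AMPLITUDE-FRONT CLOCK.** With the constant `c` of `supNorm_clock`, the toolbox
`K = lpBounds (Fin 3)` (Bernstein `L² → L^∞` constant `C_∞`) and `G = ∑_n 2^{−3n/2}` (`LPBounds.geomDim (Fin 3)`):
along every maximal smooth Leray–Hopf solution, for EVERY `t ∈ (0, T)` and EVERY level `J ∈ ℤ`,
`c √ν/√(T − t) ≤ C_∞ ‖u(0)‖₂ 2^{3(J−1)/2} G + ∑_{n≥0} s_{J+n}(t)` — the block sups below `J` add up to at most
`C_∞ G 2^{3(J−1)/2}` times the energy, which does not increase (`LPBounds.tsum_blockSup_low_le`, Leray's energy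
inequality), so at each instant either the levels at and above `J` already carry sup-amplitude `≳ √(ν/(T − t))`
or the blow-up is still far. [cite: Leray1934, §19 (3.8)–(3.9) p. 224]
[cite: BahouriCheminDanchin2011, Lemma 2.1 and Prop. 2.12] -/
theorem supFront_clock :
    ∃ c : ℝ, 0 < c ∧ ∀ (ν T : ℝ), 0 < ν → 0 < T →
      ∀ (u : ℝ → EuclideanSpace ℝ (Fin 3) → EuclideanSpace ℝ (Fin 3)) (p : ℝ → EuclideanSpace ℝ (Fin 3) → ℝ),
      IsMaximalSmoothSolution ν 0 u p T → IsLerayHopfOn T ν 0 (u 0) u →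
      ∀ t ∈ Ioo 0 T, ∀ J : ℤ, ENNReal.ofReal (c * Real.sqrt ν / Real.sqrt (T - t)) ≤
        ((lpBounds (Fin 3)).Cinf : ℝ≥0∞) * eLpNorm (u 0) 2 volume *
            (2 : ℝ≥0∞) ^ (((J - 1 : ℤ) : ℝ) * Fintype.card (Fin 3) * 2⁻¹) * LPBounds.geomDim (Fin 3) +
          ∑' n : ℕ, blockSup (u t) (J + n) := by
  obtain ⟨c, hc, H⟩ := blockSup_sum_clock
  refine ⟨c, hc, fun ν T hν hT u p hmax hLH t ht J => (H ν T hν hT u p hmax hLH t ht).trans ?_⟩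
  set K := lpBounds (Fin 3) with hK
  have hut : MemLp (u t) 2 volume := hLH.memLp t ⟨ht.1.le, ht.2.le⟩
  rw [tsum_blockSup_eq_low_add_tail (u t) J]
  gcongr
  calc ∑' n : ℕ, blockSup (u t) (J - 1 - n)
      ≤ K.Cinf * eLpNorm (u t) 2 volume * (2 : ℝ≥0∞) ^ (((J - 1 : ℤ) : ℝ) * Fintype.card (Fin 3) * 2⁻¹) *
          LPBounds.geomDim (Fin 3) := K.tsum_blockSup_low_le hut J
    _ ≤ K.Cinf * eLpNorm (u 0) 2 volume * (2 : ℝ≥0∞) ^ (((J - 1 : ℤ) : ℝ) * Fintype.card (Fin 3) * 2⁻¹) *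
          LPBounds.geomDim (Fin 3) := by
        gcongr
        exact hLH.eLpNorm_le_eLpNorm_datum hν.le (hLH.memLp 0 ⟨le_rfl, hT.le⟩) ⟨ht.1.le, ht.2.le⟩

/-- **L22″ — THE AMPLITUDE COUNTDOWN: each level the amplitude front has not passed certifies time.** With the
constant `c` of `supNorm_clock`, `C_∞ = (lpBounds (Fin 3)).Cinf` and `G = geomDim (Fin 3)`: along every maximal
smooth Leray–Hopf solution, at every `t ∈ (0, T)` and for every level `J ∈ ℤ`, IF the block sups at and above `J`
sum to no more than the energy class lets the levels below `J` carry —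
`∑_{n≥0} ‖Δ̇_{J+n} u(t)‖_∞ ≤ C_∞ ‖u(0)‖₂ 2^{3(J−1)/2} G` ('the amplitude front has not passed `J`') — THEN
`c² ν ≤ 4 (C_∞ G ‖u(0)‖₂ 2^{3(J−1)/2})² (T − t)` (real numbers): the blow-up is at least
`c² ν ‖u(0)‖₂⁻² 2^{−3(J−1)} / (4 C_∞² G²)` away; equivalently the amplitude front must climb at least like
`2^{J(t)} ≳ (ν/(T − t))^{1/3} ‖u(0)‖₂^{−2/3}`. [cite: Leray1934, §19 (3.8)–(3.9) p. 224]
[cite: BahouriCheminDanchin2011, Lemma 2.1 and Prop. 2.12] -/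
theorem supCountdown :
    ∃ c : ℝ, 0 < c ∧ ∀ (ν T : ℝ), 0 < ν → 0 < T →
      ∀ (u : ℝ → EuclideanSpace ℝ (Fin 3) → EuclideanSpace ℝ (Fin 3)) (p : ℝ → EuclideanSpace ℝ (Fin 3) → ℝ),
      IsMaximalSmoothSolution ν 0 u p T → IsLerayHopfOn T ν 0 (u 0) u →
      ∀ t ∈ Ioo 0 T, ∀ J : ℤ,
        (∑' n : ℕ, blockSup (u t) (J + n)) ≤
          ((lpBounds (Fin 3)).Cinf : ℝ≥0∞) * eLpNorm (u 0) 2 volume *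
            (2 : ℝ≥0∞) ^ (((J - 1 : ℤ) : ℝ) * Fintype.card (Fin 3) * 2⁻¹) * LPBounds.geomDim (Fin 3) →
        c ^ 2 * ν ≤ 4 * (((lpBounds (Fin 3)).Cinf : ℝ) * (LPBounds.geomDim (Fin 3)).toReal *
          (eLpNorm (u 0) 2 volume).toReal * (2 : ℝ) ^ (((J - 1 : ℤ) : ℝ) * Fintype.card (Fin 3) * 2⁻¹)) ^ 2 *
          (T - t) := by
  obtain ⟨c, hc, H⟩ := supFront_clock
  refine ⟨c, hc, fun ν T hν hT u p hmax hLH t ht J hfront => ?_⟩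
  set K := lpBounds (Fin 3) with hK
  set E : ℝ≥0∞ := eLpNorm (u 0) 2 volume with hE
  set P : ℝ≥0∞ := (2 : ℝ≥0∞) ^ (((J - 1 : ℤ) : ℝ) * Fintype.card (Fin 3) * 2⁻¹) with hP
  set G : ℝ≥0∞ := LPBounds.geomDim (Fin 3) with hG
  have hEtop : E ≠ ⊤ := (hLH.memLp 0 ⟨le_rfl, hT.le⟩).eLpNorm_ne_top
  have hPtop : P ≠ ⊤ := by
    rw [hP]
    simp [ENNReal.rpow_eq_top_iff]
  have hGtop : G ≠ ⊤ := LPBounds.geomDim_lt_top.ne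
  have hTt : 0 < T - t := sub_pos.2 ht.2
  have hsq : 0 < Real.sqrt (T - t) := Real.sqrt_pos.2 hTt
  have h := H ν T hν hT u p hmax hLH t ht J
  -- under the front hypothesis the right-hand side is at most twice the low part
  have h2 : ENNReal.ofReal (c * Real.sqrt ν / Real.sqrt (T - t)) ≤ 2 * ((K.Cinf : ℝ≥0∞) * E * P * G) :=
    calc ENNReal.ofReal (c * Real.sqrt ν / Real.sqrt (T - t))
        ≤ (K.Cinf : ℝ≥0∞) * E * P * G + ∑' n : ℕ, blockSup (u t) (J + n) := h
      _ ≤ (K.Cinf : ℝ≥0∞) * E * P * G + (K.Cinf : ℝ≥0∞) * E * P * G := add_le_add le_rfl hfront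
      _ = 2 * ((K.Cinf : ℝ≥0∞) * E * P * G) := by ring
  have hXtop : (K.Cinf : ℝ≥0∞) * E * P * G ≠ ⊤ :=
    ENNReal.mul_ne_top (ENNReal.mul_ne_top (ENNReal.mul_ne_top ENNReal.coe_ne_top hEtop) hPtop) hGtop
  -- convert to real numbers
  have h3 := ENNReal.toReal_mono (ENNReal.mul_ne_top (by norm_num) hXtop) h2
  rw [ENNReal.toReal_ofReal (by positivity)] at h3
  simp only [ENNReal.toReal_mul, ENNReal.toReal_ofNat, ENNReal.coe_toReal] at h3
  have hP' : P.toReal = (2 : ℝ) ^ (((J - 1 : ℤ) : ℝ) * Fintype.card (Fin 3) * 2⁻¹) := by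
    rw [hP, ← ENNReal.toReal_rpow]
    norm_num
  set Xr : ℝ := (K.Cinf : ℝ) * G.toReal * E.toReal * (2 : ℝ) ^ (((J - 1 : ℤ) : ℝ) * Fintype.card (Fin 3) * 2⁻¹)
    with hXr
  have hX' : (K.Cinf : ℝ) * E.toReal * P.toReal * G.toReal = Xr := by rw [hXr, hP']; ring
  have h4 : c * Real.sqrt ν / Real.sqrt (T - t) ≤ 2 * Xr := by rw [← hX']; exact h3
  have h5 : c * Real.sqrt ν ≤ 2 * Xr * Real.sqrt (T - t) := (div_le_iff₀ hsq).1 h4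
  have h6 : (c * Real.sqrt ν) ^ 2 ≤ (2 * Xr * Real.sqrt (T - t)) ^ 2 :=
    pow_le_pow_left₀ (by positivity) h5 2
  rw [mul_pow, Real.sq_sqrt hν.le, mul_pow, mul_pow, Real.sq_sqrt hTt.le] at h6
  calc c ^ 2 * ν ≤ 2 ^ 2 * Xr ^ 2 * (T - t) := h6
    _ = 4 * Xr ^ 2 * (T - t) := by norm_num

end Summit.NavierStokesRegularity.FluidComputer.LeraySupClock

end
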